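import Summits.Schanuel.Schanuel.Theorems.RootDecomp1KSkelCell02

/-!
# RootDecomp1KSkelCell — lens 1, generations 43–44 «THE QUALITY-ONLY CLASS SkelLiouville ⊋ LogLogLiouville AND ITS CERTIFIED MEMBER ρ⋆» (PRICE K-α L2033, CLAIM L2045, ACK L2046; (α) PROPER of the 1K wall map): the location-free class `SkelLiouville ρ := ∀ m ∃ r, m ≤ den r ∧ ρ ≠ r ∧ |ρ − r| < den^{−m·ι(den)}` (ι q = least N with q ≤ 2^{N!}) with `LogLogLiouville ⊊ SkelLiouville ⊆ Liouville` PROVED, the member ρ⋆ = Σ_j 2^{−2^{e_j}} (FREDHOLM SERIES WITH DELETED BLOCKS) certified HYPOTHESIS-FREE in Skel ∖ (LogLog ∪ FactorialGap), the SKEL engine + extraction, the walls (1, ℓ₂, ρ) mod hNW / π-twins and the pair (ℓ₂, ρ) HYPOTHESIS-FREE for every ρ ∈ Skel, the items APPLIED at z⋆ with all binders discharged, the m = 1 ceiling, and §9 hNW DISCHARGED BY NAME on the e-wall via the Literature proof module — continuation (RootDecomp1KSkelCell03): §5b the member rhoStar + §6 covering / quality lemmas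

(lens-1 g43/g44 HOME kernel SkelCell.lean EDITION 2 b7163857…, 2822 l, imports tree RootDecomp1KGapCell01 (+ for §9 only Literature ExpOneTranscendenceMeasureProofs); CLAIM L2045, ACK L2046 (CHECKLIST K-α (1)–(8) + the constant-dependence line of L2085 (R4)), NODE L2132 / REQUEST L2133, critic VERDICT L2140 (crit g9: CLEARED — ONE CELL credit (K-α); lens-1 tally credits ×11 + THEOREM; PORT GO in substance 01–0k `--supports stmt-Schanuel-33364`, the two scoped heartbeat raises flagged for the port record, addendum D as RootDecomp1KNWMeasureHolds GO LOW); port by census-1 gen 18 as `RootDecomp1KSkelCell01`–`11` along K's sections: 01 = §1 `iota`, `SkelLiouville`, inclusions `SkelLiouville.liouville` / `logLogLiouville_skelLiouville`; 02 = §5a anchors `aI`/`sI` + §5b the skeleton `eS`, positions `cS`, terms `aS` (up to `summable_aS`); 03 = §5b the member `rhoStar`, truncations `tS`/`rS`, bounds + §6 covering / quality lemmas; 04 = §6 THE MEMBER THEOREMS `skelLiouville_rhoStar`, `not_logLogLiouville_rhoStar`, `not_factorialGapLiouville_rhoStar`, `liouville_rhoStar`, `not_skelLiouville_subset_logLogLiouville`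 + §2 engine preliminaries (`SkelMeasure`, `exists_scale_index_iota`); 05 = §2 THE ENGINE `skelMeasure_cons_liouvilleNumber` (scoped `maxHeartbeats 800000` as in K) + `SkelMeasure.mvWeakMeasure`; 06 = §3 EXTRACTION `no_int_relation_of_skelMeasure_skelLiouville`, `sb_of_skelLiouville_of_skelMeasure`; 07 = §4 THE CELLS (pair hyp-free, walls mod hNW, π-twins) + the live items in item shape; 08 = §7 three interlaced cuts `deletedBlock_margins`, `form_lower_bound_S` (scoped `maxHeartbeats 1600000`); 09 = §7b member tuples zS2/zS3/zS3pi, scope certificates, items AT the members; 10 = §8 the fixed-multiple ladder and the m = 1 ceiling (`uStar`, `skel_fixedOne_ceiling`); 11 = §9 hNW DISCHARGED BY NAME (imports Literature ExpOneTranscendenceMeasureProofs).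
PORT EDITS: `set_option linter.dupNamespace false` dropped; the Literature import moved from the head to part 11 (the only user); K's 13 private helpers travel as per-part private copies; two generic helpers made `private` after the dedup bounce of 02 (p829539: `two_mul_le_two_pow` ≡ Literature.NumberTheory.EllipticCurves.two_mul_le_two_pow; also `log_two_lt_self` pre-emptively) and of 03 (p829791: `one_le_loglog` ≡ Literature Tao2016.EntropyDecrement.one_le_log_log; then nine more generic arithmetic helpers privatised pre-emptively: loglog_pow_pow_ge, add_factorial_mul_le_factorial_add, one_lt_ell2, partialSum_two_two, five_fourths_le_partialSum, ell2_lt, psNumer_two_cast, two_pow_lt_psNumer); statements and proofs verbatim. `--supports stmt-Schanuel-33364`; no census credit carried; rung 0 — nothing here proves Schanuel.)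
-/

open Summit.Schanuel.Schanuel.Theorems.RootDecomp1KHyper
open Summit.Schanuel.Schanuel.Theorems.RootDecomp1KHyper.HyperCell
open Summit.Schanuel.Schanuel.Theorems.RootDecomp1KGeneric
open Summit.Schanuel.Schanuel.Theorems.RootDecomp1KRelLiouvilleCell
open Summit.Schanuel.Schanuel.Theorems.RootDecomp1KLogLogCell
open Summit.Schanuel.Schanuel.Theorems.RootDecomp1KTwoBaseCell
open Summit.Schanuel.Schanuel.Theorems.RootDecomp1KGapCell
open LiouvilleNumber
open scoped Nat

namespace Summit.Schanuel.Schanuel.Theorems.RootDecomp1KSkelCell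

section Member

/-- **THE MEMBER** `ρ⋆ = Σ_j 2^{−c_j} = Σ_{n kept} 2^{−2^n}`: the Fredholm series with the blocks
`(a_i, a_i + s_i)`, `i ≥ 4`, deleted. -/
noncomputable def rhoStar : ℝ := ∑' j, aS j

/-- numerator of the `N`-th truncation: `M_N = Σ_{j ≤ N} 2^{c_N − c_j}` (odd). -/
def MS (N : ℕ) : ℕ := ∑ j ∈ Finset.range (N + 1), 2 ^ (cS N - cS j)

/-- the `N`-th truncation `t_N = Σ_{j ≤ N} 2^{−c_j}`. -/
noncomputable def tS (N : ℕ) : ℝ := ∑ j ∈ Finset.range (N + 1), aS j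

/-- `tS N = M_N / 2^{c_N}`. -/
theorem tS_eq (N : ℕ) : tS N = (MS N : ℝ) / (2 : ℝ) ^ cS N := by
  unfold tS MS aS
  push_cast
  rw [Finset.sum_div]
  refine Finset.sum_congr rfl fun j hj => ?_
  have hj' : cS j ≤ cS N := cS_strictMono.monotone (by have := Finset.mem_range.mp hj; omega)
  rw [pow_sub₀ _ (by norm_num : (2 : ℝ) ≠ 0) hj']
  field_simp

/-- the numerator is odd. -/
theorem coprime_MS (N : ℕ) : Nat.Coprime (MS N) 2 := by
  have hsplit : MS N = 2 * (∑ j ∈ Finset.range N, 2 ^ (cS N - cS j - 1)) + 1 := by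
    unfold MS
    rw [Finset.sum_range_succ, Nat.sub_self, pow_zero, Finset.mul_sum]
    congr 1
    refine Finset.sum_congr rfl fun j hj => ?_
    have hj' := Finset.mem_range.mp hj
    have h1 : cS j < cS N := cS_strictMono hj'
    obtain ⟨t, ht⟩ : ∃ t, cS N - cS j = t + 1 := ⟨cS N - cS j - 1, by omega⟩
    rw [ht, Nat.add_sub_cancel, pow_succ']
  rw [hsplit]
  exact (Nat.coprime_mul_left_add_left 1 2 _).mpr (Nat.coprime_one_left 2)

/-- `ρ⋆ = t_N + tail`. -/
theorem rhoStar_eq_tS_add (N : ℕ) : rhoStar = tS N + ∑' j, aS (j + (N + 1)) := by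
  unfold rhoStar tS
  rw [Summable.sum_add_tsum_nat_add (N + 1) summable_aS]

/-- the tail is summable. -/
theorem summable_tailS (N : ℕ) : Summable fun j => aS (j + (N + 1)) :=
  (summable_nat_add_iff (N + 1)).mpr summable_aS

/-- `0 <` tail. -/
theorem tailS_pos (N : ℕ) : 0 < ∑' j, aS (j + (N + 1)) :=
  (summable_tailS N).tsum_pos (fun _ => (aS_pos _).le) 0 (aS_pos _)

/-- tail `≤ 2 · 2^{−c_{N+1}}`. -/
theorem tailS_le (N : ℕ) : ∑' j, aS (j + (N + 1)) ≤ 2 / (2 : ℝ) ^ cS (N + 1) := by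
  have hle : ∀ j, aS (j + (N + 1)) ≤ (1 / (2 : ℝ) ^ cS (N + 1)) * (1 / 2 : ℝ) ^ j := by
    intro j
    unfold aS
    rw [one_div_pow, one_div_mul_one_div, ← pow_add]
    refine one_div_le_one_div_of_le (by positivity) (pow_le_pow_right₀ (by norm_num) ?_)
    have e : j + (N + 1) = (N + 1) + j := Nat.add_comm _ _
    rw [e]
    exact cS_add_le (N + 1) j
  have hgeo : Summable fun j : ℕ => (1 / (2 : ℝ) ^ cS (N + 1)) * (1 / 2 : ℝ) ^ j :=
    (summable_geometric_of_lt_one (by norm_num) (by norm_num)).mul_left _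
  calc ∑' j, aS (j + (N + 1)) ≤ ∑' j : ℕ, (1 / (2 : ℝ) ^ cS (N + 1)) * (1 / 2 : ℝ) ^ j :=
        (summable_tailS N).tsum_le_tsum hle hgeo
    _ = (1 / (2 : ℝ) ^ cS (N + 1)) * 2 := by
        rw [tsum_mul_left, tsum_geometric_of_lt_one (by norm_num) (by norm_num)]; norm_num
    _ = 2 / (2 : ℝ) ^ cS (N + 1) := by ring

/-- tail `≥ 2^{−c_{N+1}}` (its first term). -/
theorem tailS_ge (N : ℕ) : 1 / (2 : ℝ) ^ cS (N + 1) ≤ ∑' j, aS (j + (N + 1)) := by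
  have h := (summable_tailS N).le_tsum 0 (fun j _ => (aS_pos _).le)
  simpa [aS] using h

/-- the truncation as a rational `M_N / 2^{c_N}`. -/
def rS (N : ℕ) : ℚ := (MS N : ℚ) / (2 : ℚ) ^ cS N

/-- `((rS N : ℚ) : ℝ) = tS N`. -/
theorem rS_cast (N : ℕ) : ((rS N : ℚ) : ℝ) = tS N := by
  rw [tS_eq]; unfold rS; push_cast; rfl

/-- EXACT denominator `2^{c_N}`. -/
theorem rS_den (N : ℕ) : (rS N).den = 2 ^ cS N := by
  have hcop : Nat.Coprime ((MS N : ℤ)).natAbs (((2 : ℤ) ^ cS N)).natAbs := by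
    rw [Int.natAbs_natCast, Int.natAbs_pow]
    exact (coprime_MS N).pow_right (cS N)
  have h := Rat.den_div_eq_of_coprime (a := (MS N : ℤ)) (b := (2 : ℤ) ^ cS N) (by positivity) hcop
  have e : (((MS N : ℤ) : ℚ) / (((2 : ℤ) ^ cS N : ℤ) : ℚ)) = rS N := by unfold rS; push_cast; rfl
  rw [e] at h
  exact_mod_cast h

/-- `ρ⋆ − t_N =` tail. -/
theorem rhoStar_sub_rS (N : ℕ) : rhoStar - (rS N : ℝ) = ∑' j, aS (j + (N + 1)) := by
  rw [rS_cast, rhoStar_eq_tS_add N]; ring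

/-- `2^{−c_{N+1}} ≤ ρ⋆ − t_N ≤ 2·2^{−c_{N+1}}` and `ρ⋆ ≠ t_N`. -/
theorem rhoStar_sub_rS_bounds (N : ℕ) :
    1 / (2 : ℝ) ^ cS (N + 1) ≤ rhoStar - (rS N : ℝ) ∧ rhoStar - (rS N : ℝ) ≤ 2 / (2 : ℝ) ^ cS (N + 1) := by
  rw [rhoStar_sub_rS]; exact ⟨tailS_ge N, tailS_le N⟩

/-- `ρ⋆ ≠ t_N`. -/
theorem rhoStar_ne_rS (N : ℕ) : rhoStar ≠ (rS N : ℝ) := by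
  intro h
  have := (rhoStar_sub_rS_bounds N).1
  rw [h, sub_self] at this
  have : (0 : ℝ) < 1 / (2 : ℝ) ^ cS (N + 1) := by positivity
  linarith

/-- `0 < ρ⋆ < 1` (indeed `ρ⋆ ≤ t_0 + 2·2^{−c_1} = 1/2 + 2/4`; we only need `ρ⋆ < 1` strictly:
`c_1 = 2`, tail after `t_0` is `< ` its geometric majorant unless all steps are fillers — we use
the cruder `ρ⋆ ≤ 1` nowhere; positivity suffices). -/
theorem rhoStar_pos : 0 < rhoStar := summable_aS.tsum_pos (fun _ => (aS_pos _).le) 0 (aS_pos 0)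

end Member

/-! ## §6  The membership theorems: `ρ⋆ ∈ Skel`, `ρ⋆ ∉ LogLog`, `ρ⋆ ∉ FactorialGap`, `ρ⋆` Liouville -/

section MemberTheorems

/-- Two distinct rationals are `≥ 1/(den·den')` apart (copy of the private tree helper, GapCell01). -/
private theorem one_div_den_mul_den_le_abs_sub {s r : ℚ} (hne : s ≠ r) :
    1 / ((s.den : ℝ) * r.den) ≤ |(s : ℝ) - r| := by
  have hsd : (0 : ℝ) < s.den := by exact_mod_cast s.den_pos
  have hrd : (0 : ℝ) < r.den := by exact_mod_cast r.den_pos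
  set z : ℤ := s.num * r.den - r.num * s.den with hz
  have hsub : (s : ℝ) - r = (z : ℝ) / ((s.den : ℝ) * r.den) := by
    rw [Rat.cast_def s, Rat.cast_def r, hz]
    push_cast
    field_simp
  have hz0 : z ≠ 0 := by
    intro h0
    have : (s : ℝ) - r = 0 := by rw [hsub, h0]; simp
    exact hne (by exact_mod_cast (sub_eq_zero.mp this))
  have hz1 : (1 : ℝ) ≤ |(z : ℝ)| := by exact_mod_cast Int.one_le_abs hz0
  rw [hsub, abs_div, abs_of_pos (mul_pos hsd hrd)]
  exact div_le_div_of_nonneg_right hz1 (mul_pos hsd hrd).le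

/-- `den (t_k)` as a real: `2^{c_k}`. -/
theorem rS_den_cast (k : ℕ) : ((rS k).den : ℝ) = (2 : ℝ) ^ cS k := by
  rw [rS_den]; push_cast; rfl

/-- `(2^{c_k})² ≤ 2^{c_{k+1}}`. -/
theorem pow_cS_sq_le (k : ℕ) : ((2 : ℝ) ^ cS k) ^ 2 ≤ (2 : ℝ) ^ cS (k + 1) := by
  rw [← pow_mul]
  exact pow_le_pow_right₀ (by norm_num) (by have := two_mul_cS_le_succ k; omega)

/-- **COVERING LEMMA.**  Every rational is a truncation `t_k` of `ρ⋆`, or lies `≥ 1/(32 q³)` away from `ρ⋆`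
(comparison index: the largest `k` with `2^{c_k} ≤ 16 q²`; then `4 q 2^{c_k} ≤ 2^{c_{k+1}}` in both the
filler and the deleted-block case, with NO location hypothesis on `q`). -/
theorem rhoStar_cover (r : ℚ) : (∃ k, r = rS k) ∨ 1 / (32 * (r.den : ℝ) ^ 3) ≤ |rhoStar - r| := by
  classical
  have hq1 : 1 ≤ r.den := r.den_pos
  have hP0 : 2 ^ cS 0 ≤ 16 * r.den ^ 2 := by simp [cS]; nlinarith
  set k := Nat.findGreatest (fun k => 2 ^ cS k ≤ 16 * r.den ^ 2) (16 * r.den ^ 2) with hk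
  have hPk : 2 ^ cS k ≤ 16 * r.den ^ 2 :=
    Nat.findGreatest_spec (P := fun k => 2 ^ cS k ≤ 16 * r.den ^ 2) (Nat.zero_le _) hP0
  have hPk1 : ¬ 2 ^ cS (k + 1) ≤ 16 * r.den ^ 2 := by
    by_cases hle : k + 1 ≤ 16 * r.den ^ 2
    · exact Nat.findGreatest_is_greatest (P := fun k => 2 ^ cS k ≤ 16 * r.den ^ 2)
        (Nat.lt_succ_self _) hle
    · intro hP
      have h1 : k + 1 ≤ cS (k + 1) := self_le_cS _
      have h2 : cS (k + 1) < 2 ^ cS (k + 1) := Nat.lt_two_pow_self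
      omega
  have hQ : (2 : ℝ) ^ cS k ≤ 16 * (r.den : ℝ) ^ 2 := by exact_mod_cast hPk
  have hQ1 : 16 * (r.den : ℝ) ^ 2 < (2 : ℝ) ^ cS (k + 1) := by
    have h := not_le.mp hPk1
    exact_mod_cast h
  have hsq := pow_cS_sq_le k
  have hqR : (1 : ℝ) ≤ r.den := by exact_mod_cast hq1
  have hQpos : (0 : ℝ) < (2 : ℝ) ^ cS k := by positivity
  have h4q : (0 : ℝ) ≤ 4 * r.den := by positivity
  -- `4 q 2^{c_k} ≤ 2^{c_{k+1}}`
  have h4 : 4 * (r.den : ℝ) * (2 : ℝ) ^ cS k ≤ (2 : ℝ) ^ cS (k + 1) := by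
    by_cases hc : (2 : ℝ) ^ cS k ≤ 4 * r.den
    · nlinarith [mul_le_mul_of_nonneg_left hc h4q]
    · push Not at hc
      nlinarith [mul_le_mul_of_nonneg_left hc.le hQpos.le]
  by_cases hr : r = rS k
  · exact Or.inl ⟨k, hr⟩
  right
  have hsep := one_div_den_mul_den_le_abs_sub hr
  rw [rS_den_cast] at hsep
  have htail := (rhoStar_sub_rS_bounds k).2
  have htail0 := (rhoStar_sub_rS_bounds k).1
  have htri : |(r : ℝ) - rS k| - |rhoStar - rS k| ≤ |rhoStar - r| := by
    have h := abs_sub_abs_le_abs_sub ((r : ℝ) - rS k) (rhoStar - rS k)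
    rw [show ((r : ℝ) - rS k) - (rhoStar - rS k) = -(rhoStar - r) by ring, abs_neg] at h
    exact h
  have hp1 : (0 : ℝ) < 1 / (2 : ℝ) ^ cS (k + 1) := by positivity
  have habs : |rhoStar - (rS k : ℝ)| ≤ 2 / (2 : ℝ) ^ cS (k + 1) := by
    rw [abs_of_nonneg (by linarith)]; exact htail
  have h5 : 2 / (2 : ℝ) ^ cS (k + 1) ≤ 1 / (2 * r.den * (2 : ℝ) ^ cS k) := by
    rw [div_le_div_iff₀ (by positivity) (by positivity)]; nlinarith
  have h6 : 1 / (32 * (r.den : ℝ) ^ 3) ≤ 1 / (2 * r.den * (2 : ℝ) ^ cS k) := by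
    apply one_div_le_one_div_of_le (by positivity)
    nlinarith [mul_le_mul_of_nonneg_left hQ (by positivity : (0 : ℝ) ≤ 2 * r.den)]
  have h7 : 1 / ((r.den : ℝ) * (2 : ℝ) ^ cS k) - 1 / (2 * r.den * (2 : ℝ) ^ cS k) =
      1 / (2 * r.den * (2 : ℝ) ^ cS k) := by
    field_simp; ring
  calc 1 / (32 * (r.den : ℝ) ^ 3) ≤ 1 / (2 * r.den * (2 : ℝ) ^ cS k) := h6
    _ = 1 / ((r.den : ℝ) * (2 : ℝ) ^ cS k) - 1 / (2 * r.den * (2 : ℝ) ^ cS k) := h7.symm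
    _ ≤ |(r : ℝ) - rS k| - |rhoStar - rS k| := by linarith [hsep, habs, h5]
    _ ≤ |rhoStar - r| := htri

/-- `ι(2^{2^{a_i}}) ≤ 2^i + 1` (the anchor denominator sits below the scale `2^{(M+1)!}`, `M = 2^i`). -/
theorem iota_anchor_le (i : ℕ) : iota (2 ^ 2 ^ aI i) ≤ 2 ^ i + 1 :=
  iota_le_of_le (Nat.pow_le_pow_right two_pos (two_pow_aI_le_factorial_succ i))

/-- the hole quality beats `m · ι + 2` at the anchor `i = 2m + 4`. -/
theorem skel_quality (m : ℕ) : m * (2 ^ (2 * m + 4) + 1) + 2 ≤ 2 ^ sI (2 * m + 4) := by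
  have h1 := two_pow_mul_succ_le (2 * m + 4)
  have hM : 2 * m + 4 ≤ 2 ^ (2 * m + 4) := (Nat.lt_two_pow_self).le
  nlinarith [h1, hM]

/-- `1 ≤ log log q` for `q ≥ 16`. -/
private theorem one_le_loglog {q : ℝ} (hq : 16 ≤ q) : 1 ≤ Real.log (Real.log q) := by
  have h2 := Real.log_two_gt_d9
  have he := Real.exp_one_lt_d9
  have h16 : Real.log 16 = (4 : ℕ) * Real.log 2 := by
    rw [← Real.log_pow]; norm_num
  have hlog16 : Real.exp 1 ≤ Real.log 16 := by rw [h16]; push_cast; linarith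
  have hlogq : Real.log 16 ≤ Real.log q := Real.log_le_log (by norm_num) hq
  rw [Real.le_log_iff_exp_le (by linarith [Real.exp_pos 1])]
  linarith

/-- `a/2 ≤ log log 2^{2^a}` for `a ≥ 4`. -/
private theorem loglog_pow_pow_ge {a : ℕ} (ha : 4 ≤ a) :
    (a : ℝ) / 2 ≤ Real.log (Real.log ((2 : ℝ) ^ (2 ^ a))) := by
  have h2 := Real.log_two_gt_d9
  have hlog : Real.log ((2 : ℝ) ^ (2 ^ a)) = (2 : ℝ) ^ a * Real.log 2 := by
    rw [Real.log_pow]; push_cast; ring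
  have hll : -(1 / 2 : ℝ) ≤ Real.log (Real.log 2) := by
    rw [Real.le_log_iff_exp_le (by linarith)]
    have h1 : 1 + 1 / 2 ≤ Real.exp (1 / 2 : ℝ) := by
      linarith [Real.add_one_le_exp (1 / 2 : ℝ)]
    have h3 : Real.exp (-(1 / 2 : ℝ)) = 1 / Real.exp (1 / 2) := by rw [Real.exp_neg, inv_eq_one_div]
    rw [h3, div_le_iff₀ (Real.exp_pos _)]
    nlinarith
  rw [hlog, Real.log_mul (by positivity) (by linarith), Real.log_pow]
  have ha' : (4 : ℝ) ≤ a := by exact_mod_cast ha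
  nlinarith [mul_le_mul_of_nonneg_left h2.le (by linarith : (0 : ℝ) ≤ a)]

end MemberTheorems

end Summit.Schanuel.Schanuel.Theorems.RootDecomp1KSkelCell
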